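import Literature.NumberTheory.EllipticCurves.NewformGaloisRep
import HarnessLib

/-!
# Deligne–Serre (weight one): decomposition of `exists_complexGaloisRep_of_weight_one`

D-0014 keeps `Literature/` sorry-free by stating cited results as named facts `def X : Prop`.
The named fact `Literature.NumberTheory.EllipticCurves.ModularForms.exists_complexGaloisRep_of_weight_one` of
`Literature.NumberTheory.EllipticCurves.NewformGaloisRep` is the Deligne–Serre theorem
(Deligne–Serre 1974, Thm. 4.1 with §3 (a) and Rem. 4.5): a weight-one newform `f ∈ S_1(Γ₁(N))`
has an attached continuous representation `ρ_f : Γ_ℚ → GL₂(ℂ)`, unramified outside `N`, with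
`charpoly ρ_f(Frob_p) = X² − a_p X + ε(p)` (`p ∤ N`), of finite image, irreducible and odd.

Its printed proof (op. cit. §§5–8) rests on Deligne's `λ`-adic representations in weight `≥ 2`
(Thm. 6.1, étale cohomology), a Rankin–Selberg estimate (Prop. 5.1, 5.5), reduction and
lifting of eigenvalues mod `λ` (Thm. 6.7, Lemma 6.11), a bound on subgroups of `GL₂(𝔽_ℓ)`
(Prop. 7.2) and the Chebotarev density theorem (Lemma 3.2, 8.3), none of which Mathlib has.
This sibling file records the *top layer* of that proof as three named facts, each carrying
the source's own numbering, and proves the assembly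

* `exists_complexGaloisRep_of_weight_one_of`:
  `thm41_exists → thm41_isIrreducible → rem45_isOdd → exists_complexGaloisRep_of_weight_one`.

## The three constituents (namespace `Literature.ModularForms.DeligneSerre1974`)

* `thm41_exists` — Thm. 4.1, first assertion, with §3 (a): existence of `ρ` attached to `f`
  away from `N` (`IsGaloisRepOfNewform1 f ι {p ∣ N} ρ`: unramified at `p ∤ N`, arithmetic
  Frobenius has characteristic polynomial `X² − a_p X + ε(p)`), with finite image (the source
  gives `ℂ` the discrete topology, §3 (a): "dans les deux premiers cas, l'image de `ρ` est
  finie"). Proof: op. cit. §8.1–8.6.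
* `thm41_isIrreducible` — Thm. 4.1, second assertion ("`ρ` est irréductible si et seulement si
  `f` est parabolique"; our `f` is a cusp form), for *every* finite-image `ρ` attached to `f`
  away from `N`: by Lemma 3.2 and Rem. 3.4/4.3 such a `ρ` is unique up to isomorphism, and
  irreducibility (Mathlib `Representation.IsIrreducible` of the underlying representation on
  `Fin 2 → ℂ`) is isomorphism-invariant. Proof: op. cit. §8.7 (from Prop. 5.1).
* `rem45_isOdd` — Rem. 4.4 (`det ρ = ε` via class field theory and Chebotarev) and Rem. 4.5
  (`ε(−1) = −1`, forced by `f ≠ 0` of weight `1`, gives `det ρ(c) = −1`), again for every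
  finite-image `ρ` attached to `f` away from `N`.

## Design notes

* The hypotheses of the source (`f` of type `(1, ε)` on `Γ₀(N)`, `f ≠ 0`, eigenfunction of the
  `T_p`, `p ∤ N`, `ε(−1) = −1`) are implied by `IsNewform1 f` for `f : CuspForm (Gamma1 N) 1`
  (normalised new eigenform, eigenvector of the diamond operators, `ε = nebentypus f`,
  `a_p =` the `T_p`-eigenvalue for a normalised eigenform); the vendored facts keep the parent
  fact's specialisation to newforms and do not restate the Eisenstein case (§8.1).
* Nothing here weakens `exists_complexGaloisRep_of_weight_one`; the three facts are stated with
  the *same* carriers (`FramedGaloisRep ℚ ℂ 2`, `IsGaloisRepOfNewform1`, `Set.range ρ` finite,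
  `ContinuousRep.IsIrreducible`, `FramedGaloisRep.IsOdd`) so that the assembly is definitional.
* Lower layers (Lemma 6.11, Prop. 7.2, Prop. 5.1/5.5, Thm. 6.7, Lemma 3.2) are to be vendored
  and proved bottom-up in later sessions; see the fact-owner's NOTES.

## References

* P. Deligne, J.-P. Serre, *Formes modulaires de poids 1*, Ann. Sci. ÉNS (4) 7 (1974),
  507–530, doi:10.24033/asens.1277 — §3 (a), Lemma 3.2, Rem. 3.4, Thm. 4.1, Rem. 4.3–4.5, §8.
-/

noncomputable section

open scoped MatrixGroups ModularForm NumberField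

open CongruenceSubgroup

namespace Literature.NumberTheory.EllipticCurves.ModularForms

variable {N : ℕ} [NeZero N]

namespace DeligneSerre1974

/-- **Deligne–Serre 1974, Thm. 4.1 (existence) with §3 (a).** Let `f ∈ S_1(Γ₁(N))` be a newform
of weight one, with Fourier coefficients `a_p` and nebentypus `ε`. There is a continuous
representation `ρ : Gal(ℚ̄/ℚ) → GL₂(ℂ)` with finite image ("`ℂ` avec la topologie discrète …
l'image de `ρ` est finie", §3 (a)), unramified outside `N`, such that for every prime `p ∤ N`
the arithmetic Frobenius satisfies `Tr(F_p) = a_p` and `det(F_p) = ε(p)` (4.1.1), i.e.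
`charpoly ρ(F_p) = X² − a_p X + ε(p)` (`IsGaloisRepOfNewform1 f ι {p ∣ N} ρ`, weight `1` so
`p^{k−1} = 1`). Proof: op. cit. §8.1–8.6. [cite: DeligneSerreASENS1974, Thm. 4.1 and §3 (a)] -/
def thm41_exists : Prop :=
  ∀ {f : CuspForm (Gamma1 N) 1} (_hf : IsNewform1 f),
    ∃ ρ : GaloisRepresentations.FramedGaloisRep ℚ ℂ 2,
      IsGaloisRepOfNewform1 f (algebraMap (coeffCharField f) ℂ) {p | p ∣ N} ρ ∧
        (Set.range ρ).Finite

/-- **Deligne–Serre 1974, Thm. 4.1 (irreducibility).** Let `f ∈ S_1(Γ₁(N))` be a newform of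
weight one (in particular parabolic) and let `ρ : Gal(ℚ̄/ℚ) → GL₂(ℂ)` be a representation with
finite image attached to `f` away from `N` (unramified at `p ∤ N` with
`charpoly ρ(F_p) = X² − a_p X + ε(p)`). Then `ρ` is irreducible. In the source this is stated
for the representation of Thm. 4.1 ("cette représentation est irréductible si et seulement si
`f` est parabolique"); by Lemma 3.2 with Rem. 3.4 (finite image ⇒ semisimple) and Rem. 4.3 any
such `ρ` is isomorphic to it, and irreducibility is isomorphism-invariant. Proof: op. cit. §8.7.
[cite: DeligneSerreASENS1974, Thm. 4.1 with Lemma 3.2 and Rem. 4.3] -/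
def thm41_isIrreducible : Prop :=
  ∀ {f : CuspForm (Gamma1 N) 1} (_hf : IsNewform1 f) (ρ : GaloisRepresentations.FramedGaloisRep ℚ ℂ 2),
    IsGaloisRepOfNewform1 f (algebraMap (coeffCharField f) ℂ) {p | p ∣ N} ρ →
      (Set.range ρ).Finite → ρ.toGaloisRep.IsIrreducible

/-- **Deligne–Serre 1974, Rem. 4.4–4.5 (oddness).** Let `f ∈ S_1(Γ₁(N))` be a newform of weight
one with nebentypus `ε` and let `ρ : Gal(ℚ̄/ℚ) → GL₂(ℂ)` be a representation with finite image
attached to `f` away from `N`. The formula `det(F_p) = ε(p)` (`p ∤ N`) shows `det ρ = ε`, `ε`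
being identified with a character of `Gal(ℚ̄/ℚ)` by class field theory (Rem. 4.4); since `ε` is
odd (`ε(−1) = −1`, forced by `f ≠ 0` of weight `1`, hypothesis of Thm. 4.1), `det ρ(c) = −1` for
every complex conjugation `c` (Rem. 4.5), i.e. `ρ` is odd (`FramedGaloisRep.IsOdd`).
[cite: DeligneSerreASENS1974, Rem. 4.4 and Rem. 4.5] -/
def rem45_isOdd : Prop :=
  ∀ {f : CuspForm (Gamma1 N) 1} (_hf : IsNewform1 f) (ρ : GaloisRepresentations.FramedGaloisRep ℚ ℂ 2),
    IsGaloisRepOfNewform1 f (algebraMap (coeffCharField f) ℂ) {p | p ∣ N} ρ →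
      (Set.range ρ).Finite → ρ.IsOdd

end DeligneSerre1974

open DeligneSerre1974 in
/-- **Assembly of the Deligne–Serre theorem** from its three printed constituents: existence of a
finite-image representation attached to `f` away from `N` (Thm. 4.1, §8.1–8.6), its
irreducibility for parabolic `f` (Thm. 4.1, §8.7) and its oddness (Rem. 4.4–4.5) give
`exists_complexGaloisRep_of_weight_one`. [cite: DeligneSerreASENS1974, Thm. 4.1 and Rem. 4.5] -/
theorem exists_complexGaloisRep_of_weight_one_of (hex : thm41_exists (N := N))
    (hirr : thm41_isIrreducible (N := N)) (hodd : rem45_isOdd (N := N)) :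
    exists_complexGaloisRep_of_weight_one (N := N) := by
  intro f hf
  obtain ⟨ρ, hρ, hfin⟩ := hex hf
  exact ⟨ρ, hρ, hirr hf ρ hρ hfin, hfin, hodd hf ρ hρ hfin⟩

end Literature.NumberTheory.EllipticCurves.ModularForms
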